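import Mathlib
import Summits.Ventures.PercRepro2.TypedBundleSeven

/-!
# The domain of record is not empty: p3 g6's 13-edge instance lies in
`ResidualCoreNHatCTBRASUDO7` (blind cell PercRepro2, p2 g6, 2026-08-25; the lead's R-SEP3 (c))

Vertices `0 = o, 1 = a₁, 2 = a₂, 3 = a₃, 4 = b, 5 = u, 6 = w, 7 = y, 8 = z`; the thirteen typed edges
`o–u, o–w, u–a₁, u–a₃, w–a₁, w–a₃, y–a₁, y–a₃, y–a₂, y–b, z–a₂, z–b, z–a₃`, every edge typed
(`F = univ`, `z ≡ false`).  **`instance13_mem`**: the instance satisfies the twelve conditions of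
the domain of record AS STATED IN LEAN — the decidable conditions by `decide +kernel` (`Conn` is
decidable on a finite graph), the `Set`-quantified ones (the cuts, the two-terminal parts, the root
bundles) by the attachment arguments (every unmarked vertex has three typed edges to three
distinct marks, two of them non-roots), the two «no configuration below `F`» conditions by an
explicit badly crossed / `o`-not-behind-`a₃` configuration.  Own code; standard axioms.
-/

namespace Summit.Ventures.PercRepro2

open UnionCluster

namespace CovForm

namespace TypedRed

namespace NonVacuity

open Separated (zF)

/-- p3 g6's 13-edge instance: `0 = o, 1 = a₁, 2 = a₂, 3 = a₃, 4 = b, 5 = u, 6 = w, 7 = y, 8 = z`. -/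
def ends13 : Fin 13 → Sym2 (Fin 9) :=
  ![s(0, 5), s(0, 6), s(5, 1), s(5, 3), s(6, 1), s(6, 3), s(7, 1), s(7, 3), s(7, 2), s(7, 4),
    s(8, 2), s(8, 4), s(8, 3)]

/-- Its typed edge set: every edge. -/
abbrev F13 : Finset (Fin 13) := Finset.univ

section Generic

variable {V : Type*} {E : Type*}

/-- An edge within `S` has both ends in `S`. -/
lemma ends_mem_of_within {ends : E → Sym2 V} {S : Set V} {e : E} {x y : V} (h : ends e = s(x, y))
    (hw : e ∈ within ends S) : x ∈ S ∧ y ∈ S := by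
  obtain ⟨x', hx', y', hy', hxy⟩ := hw
  rw [h, Sym2.eq_iff] at hxy
  rcases hxy with ⟨rfl, rfl⟩ | ⟨rfl, rfl⟩
  · exact ⟨hx', hy'⟩
  · exact ⟨hy', hx'⟩

end Generic

/-! ## The decidable conditions -/

set_option synthInstance.maxHeartbeats 400000
set_option synthInstance.maxSize 1024

/-- The marks are distinct. -/
theorem marks13 : MarksDistinct (0 : Fin 9) 1 2 3 4 := by
  unfold MarksDistinct RootsDistinct; decide

/-- The instance is fully reduced. -/
theorem reduced13 : Reduced ends13 0 1 2 3 4 F13 := by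
  refine ⟨?_, ?_, ?_, ?_, ?_, ?_, ?_⟩ <;> decide +kernel

/-- The instance is residual. -/
theorem residual13 : Residual ends13 0 1 2 3 4 F13 :=
  ⟨reduced13, by decide, by decide +kernel, by decide +kernel, by decide +kernel, by decide +kernel⟩

/-- The roots are joined. -/
theorem con13 : Conn ends13 (typedConfig F13) 1 2 := by decide +kernel

/-- Every typed edge is root-reachable. -/
theorem rootReach13 : ∀ e ∈ F13, ∃ p ∈ ends13 e,
    Conn ends13 (typedConfig F13) 1 p ∨ Conn ends13 (typedConfig F13) 2 p := by decide +kernel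

/-- No same-side root bridge. -/
theorem noBridge13 : ¬ RootBridge.HasRootBridgeSameSide' ends13 0 1 2 4 F13 := by
  simp only [RootBridge.HasRootBridgeSameSide', mem_cluster]; decide +kernel

/-- The core of the domain. -/
theorem core13 : ResidualCore ends13 0 1 2 3 4 F13 :=
  ⟨⟨⟨residual13, con13⟩, rootReach13⟩, noBridge13, marks13⟩

/-- `u = 5` is not a hat (no typed edge `u–a₂`). -/
theorem notHat5 : ¬ IsHat ends13 0 1 2 3 4 F13 5 := by
  unfold IsHat; decide +kernel

/-- Not every unmarked typed vertex is a hat. -/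
theorem noHats13 : ¬ Hats ends13 0 1 2 3 4 F13 := fun h =>
  notHat5 (h 5 (by decide) (by decide) (by decide) (by decide) (by decide) ⟨2, by decide, by decide⟩)

/-- Among any three edges, one of the four edges at `u` / `w` is left over, with an unmarked end. -/
theorem key_star : ∀ e₁ e₂ e₃ : Fin 13, ∃ e : Fin 13, e ≠ e₁ ∧ e ≠ e₂ ∧ e ≠ e₃ ∧
    ∃ v : Fin 9, v ∈ ends13 e ∧ v ≠ 0 ∧ v ≠ 1 ∧ v ≠ 2 ∧ v ≠ 3 ∧ v ≠ 4 := by decide +kernel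

/-- Not a one-star. -/
theorem noOneStar13 : ¬ OneStar ends13 0 1 2 3 4 F13 := by
  rintro ⟨u, v₁, v₂, v₃, e₁, e₂, e₃, -, -, -, -, -, -, -, -, -, -, -, -, -, -, hall⟩
  obtain ⟨e, h1, h2, h3, v, hv, hv0, hv1, hv2, hv3, hv4⟩ := key_star e₁ e₂ e₃
  rcases hall e (Finset.mem_univ e) h1 h2 h3 v hv with h | h | h | h | h <;> contradiction

/-! ## The cuts -/

/-- The typed configuration at `z ≡ false` is every edge open. -/
theorem zF13 (e : Fin 13) : zF F13 (fun _ => false) e = true := by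
  simp [Separated.zF]

/-- An unmarked vertex of `Fin 9` is one of `5, 6, 7, 8`. -/
theorem unmarked_cases : ∀ x : Fin 9, x ≠ 0 → x ≠ 1 → x ≠ 2 → x ≠ 3 → x ≠ 4 →
    x = 5 ∨ x = 6 ∨ x = 7 ∨ x = 8 := by decide

/-- No cut at the root `a₁`. -/
theorem noCutA1 : ¬ RootBridge.HasCutAtRoot ends13 0 1 2 3 4 F13 := by
  rintro ⟨VL, VH, hc⟩
  have h0 : (0 : Fin 9) ∉ VH := fun h => by have := hc.cap 0 hc.oL h; exact absurd this (by decide)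
  have h3 : (3 : Fin 9) ∉ VL := fun h => by have := hc.cap 3 h hc.a3H; exact absurd this (by decide)
  have e0 := hc.split 0 (zF13 0)
  have e3 := hc.split 3 (zF13 3)
  rcases e0 with w0 | w0
  · have h5L := (ends_mem_of_within (x := 0) (y := 5) rfl w0).2
    rcases e3 with w3 | w3
    · exact h3 (ends_mem_of_within (x := 5) (y := 3) rfl w3).2
    · have h5H := (ends_mem_of_within (x := 5) (y := 3) rfl w3).1
      have := hc.cap 5 h5L h5H; exact absurd this (by decide)
  · exact h0 (ends_mem_of_within (x := 0) (y := 5) rfl w0).1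

/-- No cut at the root `a₂` (the roots swapped). -/
theorem noCutA2 : ¬ RootBridge.HasCutAtRoot ends13 0 2 1 3 4 F13 := by
  rintro ⟨VL, VH, hc⟩
  have h0 : (0 : Fin 9) ∉ VH := fun h => by have := hc.cap 0 hc.oL h; exact absurd this (by decide)
  have h3 : (3 : Fin 9) ∉ VL := fun h => by have := hc.cap 3 h hc.a3H; exact absurd this (by decide)
  have e0 := hc.split 0 (zF13 0)
  have e3 := hc.split 3 (zF13 3)
  rcases e0 with w0 | w0
  · have h5L := (ends_mem_of_within (x := 0) (y := 5) rfl w0).2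
    rcases e3 with w3 | w3
    · exact h3 (ends_mem_of_within (x := 5) (y := 3) rfl w3).2
    · have h5H := (ends_mem_of_within (x := 5) (y := 3) rfl w3).1
      have := hc.cap 5 h5L h5H; exact absurd this (by decide)
  · exact h0 (ends_mem_of_within (x := 0) (y := 5) rfl w0).1

/-- No root cut. -/
theorem noRootCut13 : ¬ HasRootCut ends13 0 1 2 3 4 F13 := by
  rintro (h | h)
  · exact noCutA1 h
  · exact noCutA2 h

/-- No cut-roots class (`M_H = ∅`): `u` and `w` would both be the cut vertex. -/
theorem noCutRoots13 : ¬ RootBridge.HasCutRoots ends13 0 1 2 3 4 F13 := by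
  rintro ⟨c, VL, VH, hc⟩
  have h1 : (1 : Fin 9) ∉ VL := fun h => hc.a1c (hc.cap 1 h hc.a1H)
  have h3 : (3 : Fin 9) ∉ VH := fun h => hc.a3c (hc.cap 3 hc.a3L h)
  -- `u = 5` is the cut vertex
  have hu : (5 : Fin 9) = c := by
    have e2 := hc.split 2 (zF13 2)
    have e3 := hc.split 3 (zF13 3)
    have h5H : (5 : Fin 9) ∈ VH := by
      rcases e2 with w | w
      · exact absurd (ends_mem_of_within (x := 5) (y := 1) rfl w).2 h1
      · exact (ends_mem_of_within (x := 5) (y := 1) rfl w).1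
    rcases e3 with w | w
    · exact hc.cap 5 (ends_mem_of_within (x := 5) (y := 3) rfl w).1 h5H
    · exact absurd (ends_mem_of_within (x := 5) (y := 3) rfl w).2 h3
  -- and so is `w = 6`
  have hw : (6 : Fin 9) = c := by
    have e4 := hc.split 4 (zF13 4)
    have e5 := hc.split 5 (zF13 5)
    have h6H : (6 : Fin 9) ∈ VH := by
      rcases e4 with w | w
      · exact absurd (ends_mem_of_within (x := 6) (y := 1) rfl w).2 h1
      · exact (ends_mem_of_within (x := 6) (y := 1) rfl w).1
    rcases e5 with w | w
    · exact hc.cap 6 (ends_mem_of_within (x := 6) (y := 3) rfl w).1 h6H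
    · exact absurd (ends_mem_of_within (x := 6) (y := 3) rfl w).2 h3
  exact absurd (hu.trans hw.symm) (by decide)

/-- No cut-roots-`a₃` class (`M_H = {a₃}`): `u` and `w` would both be the cut vertex. -/
theorem noCutRootsA3_13 : ¬ RootBridge.HasCutRootsA3 ends13 0 1 2 3 4 F13 := by
  rintro ⟨c, VL, VH, hc⟩
  have h1 : (1 : Fin 9) ∉ VL := fun h => hc.a1c (hc.cap 1 h hc.a1H)
  have h0 : (0 : Fin 9) ∉ VH := fun h => hc.oc (hc.cap 0 hc.oL h)
  have hu : (5 : Fin 9) = c := by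
    have e2 := hc.split 2 (zF13 2)
    have e0 := hc.split 0 (zF13 0)
    have h5H : (5 : Fin 9) ∈ VH := by
      rcases e2 with w | w
      · exact absurd (ends_mem_of_within (x := 5) (y := 1) rfl w).2 h1
      · exact (ends_mem_of_within (x := 5) (y := 1) rfl w).1
    rcases e0 with w | w
    · exact hc.cap 5 (ends_mem_of_within (x := 0) (y := 5) rfl w).2 h5H
    · exact absurd (ends_mem_of_within (x := 0) (y := 5) rfl w).1 h0
  have hw : (6 : Fin 9) = c := by
    have e4 := hc.split 4 (zF13 4)
    have e1 := hc.split 1 (zF13 1)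
    have h6H : (6 : Fin 9) ∈ VH := by
      rcases e4 with w | w
      · exact absurd (ends_mem_of_within (x := 6) (y := 1) rfl w).2 h1
      · exact (ends_mem_of_within (x := 6) (y := 1) rfl w).1
    rcases e1 with w | w
    · exact hc.cap 6 (ends_mem_of_within (x := 0) (y := 6) rfl w).2 h6H
    · exact absurd (ends_mem_of_within (x := 0) (y := 6) rfl w).1 h0
  exact absurd (hu.trans hw.symm) (by decide)

/-! ## The two-terminal parts and the root bundles -/

/-- Witnesses: three typed edges at each unmarked vertex and their marked other ends. -/
def wit3 : Fin 9 → (Fin 13 × Fin 13 × Fin 13) × (Fin 9 × Fin 9 × Fin 9)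
  | 5 => ((0, 2, 3), (0, 1, 3))
  | 6 => ((1, 4, 5), (0, 1, 3))
  | 7 => ((6, 7, 9), (1, 3, 4))
  | 8 => ((10, 11, 12), (2, 4, 3))
  | _ => ((0, 0, 0), (0, 0, 0))

/-- Three typed edges at each unmarked vertex, with three distinct marked other ends. -/
theorem three_marks : ∀ x : Fin 9, x = 5 ∨ x = 6 ∨ x = 7 ∨ x = 8 →
    ends13 (wit3 x).1.1 = s(x, (wit3 x).2.1) ∧ ends13 (wit3 x).1.2.1 = s(x, (wit3 x).2.2.1) ∧
      ends13 (wit3 x).1.2.2 = s(x, (wit3 x).2.2.2) ∧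
      (wit3 x).2.1 ≠ (wit3 x).2.2.1 ∧ (wit3 x).2.1 ≠ (wit3 x).2.2.2 ∧ (wit3 x).2.2.1 ≠ (wit3 x).2.2.2 ∧
      ((wit3 x).2.1 = 0 ∨ (wit3 x).2.1 = 1 ∨ (wit3 x).2.1 = 2 ∨ (wit3 x).2.1 = 3 ∨ (wit3 x).2.1 = 4) ∧
      ((wit3 x).2.2.1 = 0 ∨ (wit3 x).2.2.1 = 1 ∨ (wit3 x).2.2.1 = 2 ∨ (wit3 x).2.2.1 = 3 ∨
        (wit3 x).2.2.1 = 4) ∧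
      ((wit3 x).2.2.2 = 0 ∨ (wit3 x).2.2.2 = 1 ∨ (wit3 x).2.2.2 = 2 ∨ (wit3 x).2.2.2 = 3 ∨
        (wit3 x).2.2.2 = 4) := by decide +kernel

/-- Witnesses: two typed edges at each unmarked vertex whose other ends are distinct non-root marks. -/
def wit2 : Fin 9 → (Fin 13 × Fin 13) × (Fin 9 × Fin 9)
  | 5 => ((0, 3), (0, 3))
  | 6 => ((1, 5), (0, 3))
  | 7 => ((7, 9), (3, 4))
  | 8 => ((11, 12), (4, 3))
  | _ => ((0, 0), (0, 0))

/-- Two typed edges at each unmarked vertex whose other ends are two distinct non-root marks. -/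
theorem two_nonroot_marks : ∀ x : Fin 9, x = 5 ∨ x = 6 ∨ x = 7 ∨ x = 8 →
    ends13 (wit2 x).1.1 = s(x, (wit2 x).2.1) ∧ ends13 (wit2 x).1.2 = s(x, (wit2 x).2.2) ∧
      (wit2 x).2.1 ≠ (wit2 x).2.2 ∧
      ((wit2 x).2.1 = 0 ∨ (wit2 x).2.1 = 3 ∨ (wit2 x).2.1 = 4) ∧
      ((wit2 x).2.2 = 0 ∨ (wit2 x).2.2 = 3 ∨ (wit2 x).2.2 = 4) := by decide +kernel

/-- An edge with both ends in `{s, t}` is the edge `s–t` (no loops). -/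
theorem edge_of_ends_in_pair : ∀ e : Fin 13, ∀ s t : Fin 9,
    (∀ v : Fin 9, v ∈ ends13 e → v = s ∨ v = t) → ends13 e = s(s, t) := by decide +kernel

/-- No two distinct typed edges are parallel. -/
theorem no_parallel13 : ∀ e f : Fin 13, e ≠ f → ends13 e ≠ ends13 f := by decide +kernel

/-- An edge with both ends in `{v, a₁, a₂}` is `v–a₁` or `v–a₂` (no loops, no root pair). -/
theorem edge_of_ends_in_triple : ∀ e : Fin 13, ∀ v : Fin 9,
    (∀ x : Fin 9, x ∈ ends13 e → x = v ∨ x = 1 ∨ x = 2) → ends13 e = s(v, 1) ∨ ends13 e = s(v, 2) := by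
  decide +kernel

/-- At most two typed edges join `v` to the roots. -/
theorem card_root_edges_le_two : ∀ v : Fin 9,
    (Finset.univ.filter fun e : Fin 13 => ends13 e = s(v, 1) ∨ ends13 e = s(v, 2)).card ≤ 2 := by
  decide +kernel

/-- A mark is not in an unmarked set. -/
theorem mark_not_mem {I : Set (Fin 9)} (hI : ∀ v ∈ I, v ≠ 0 ∧ v ≠ 1 ∧ v ≠ 2 ∧ v ≠ 3 ∧ v ≠ 4)
    {m : Fin 9} (hm : m = 0 ∨ m = 1 ∨ m = 2 ∨ m = 3 ∨ m = 4) : m ∉ I := fun h => by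
  obtain ⟨h0, h1, h2, h3, h4⟩ := hI m h
  rcases hm with rfl | rfl | rfl | rfl | rfl <;> contradiction

/-- No two-terminal part. -/
theorem noTwoTerminal13 : ¬ HasTwoTerminalPart ends13 0 1 2 3 4 F13 := by
  rintro ⟨I, s, t, L, h⟩
  by_cases hI : ∃ x, x ∈ I
  · obtain ⟨x, hx⟩ := hI
    obtain ⟨hx0, hx1, hx2, hx3, hx4⟩ := h.unmarked x hx
    obtain ⟨he₁, he₂, he₃, h12, h13, h23, hm₁, hm₂, hm₃⟩ :=
      three_marks x (unmarked_cases x hx0 hx1 hx2 hx3 hx4)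
    -- the three edges are in `L` (they are typed edges at `x ∈ I`)
    have inL : ∀ e : Fin 13, ∀ m : Fin 9, ends13 e = s(x, m) → e ∈ L := fun e m he => by
      by_contra hL
      exact h.closed e hL ⟨x, hx, by rw [he]; exact Sym2.mem_mk_left x m⟩ (Finset.mem_univ e)
    -- their other ends are marks, hence not in `I`, hence `s` or `t`
    have st : ∀ e : Fin 13, ∀ m : Fin 9, ends13 e = s(x, m) →
        (m = 0 ∨ m = 1 ∨ m = 2 ∨ m = 3 ∨ m = 4) → m = s ∨ m = t := fun e m he hm => by
      rcases h.ends_in e (inL e m he) m (by rw [he]; exact Sym2.mem_mk_right x m) with hI' | hs | ht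
      · exact absurd hI' (mark_not_mem h.unmarked hm)
      · exact Or.inl hs
      · exact Or.inr ht
    have s1 := st _ _ he₁ hm₁
    have s2 := st _ _ he₂ hm₂
    have s3 := st _ _ he₃ hm₃
    rcases s1 with h1 | h1 <;> rcases s2 with h2 | h2 <;> rcases s3 with h3 | h3 <;>
      first | exact h12 (h1.trans h2.symm) | exact h13 (h1.trans h3.symm) | exact h23 (h2.trans h3.symm)
  · -- `I = ∅`: two distinct typed edges with both ends in `{s, t}` would be parallel
    push Not at hI
    obtain ⟨e, he, f, hf, hef⟩ := Finset.one_lt_card.1 h.two_le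
    have pair : ∀ g ∈ L, ends13 g = s(s, t) := fun g hg =>
      edge_of_ends_in_pair g s t fun v hv => by
        rcases h.ends_in g hg v hv with hI' | hs | ht
        · exact absurd hI' (hI v)
        · exact Or.inl hs
        · exact Or.inr ht
    exact no_parallel13 e f hef ((pair e he).trans (pair f hf).symm)

/-- No root bundle. -/
theorem noRootBundle13 : ¬ HasRootBundle ends13 0 1 2 3 4 F13 := by
  rintro ⟨I, v, L, h⟩
  by_cases hI : ∃ x, x ∈ I
  · obtain ⟨x, hx⟩ := hI
    obtain ⟨hx0, hx1, hx2, hx3, hx4⟩ := h.unmarked x hx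
    obtain ⟨he₁, he₂, h12, hm₁, hm₂⟩ :=
      two_nonroot_marks x (unmarked_cases x hx0 hx1 hx2 hx3 hx4)
    have inL : ∀ e : Fin 13, ∀ m : Fin 9, ends13 e = s(x, m) → e ∈ L := fun e m he => by
      by_contra hL
      exact h.closed e hL ⟨x, hx, by rw [he]; exact Sym2.mem_mk_left x m⟩ (Finset.mem_univ e)
    -- a non-root mark at `x` must be `v`
    have isv : ∀ e : Fin 13, ∀ m : Fin 9, ends13 e = s(x, m) → (m = 0 ∨ m = 3 ∨ m = 4) → m = v :=
      fun e m he hm => by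
        rcases h.ends_in e (inL e m he) m (by rw [he]; exact Sym2.mem_mk_right x m) with
          hI' | hv | h1 | h2
        · exact absurd hI' (mark_not_mem h.unmarked (by rcases hm with rfl | rfl | rfl <;> simp))
        · exact hv
        · exact absurd h1 (by rcases hm with rfl | rfl | rfl <;> decide)
        · exact absurd h2 (by rcases hm with rfl | rfl | rfl <;> decide)
    exact h12 ((isv _ _ he₁ hm₁).trans (isv _ _ he₂ hm₂).symm)
  · -- `I = ∅`: every edge of `L` is `v–a₁` or `v–a₂`, so `|L| ≤ 2`
    push Not at hI
    have sub : L ⊆ Finset.univ.filter fun e : Fin 13 => ends13 e = s(v, 1) ∨ ends13 e = s(v, 2) := by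
      intro g hg
      refine Finset.mem_filter.2 ⟨Finset.mem_univ g, edge_of_ends_in_triple g v fun x hx => ?_⟩
      rcases h.ends_in g hg x hx with hI' | hv | h1 | h2
      · exact absurd hI' (hI x)
      · exact Or.inl hv
      · exact Or.inr (Or.inl h1)
      · exact Or.inr (Or.inr h2)
    have := (Finset.card_le_card sub).trans (card_root_edges_le_two v)
    have := h.three_le
    omega

/-! ## The configurations -/

/-- The badly crossed configuration `u–a₁, u–a₃, z–a₂, z–b`. -/
def xBad : Config (Fin 13) := fun e => decide (e = 2 ∨ e = 3 ∨ e = 10 ∨ e = 11)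

/-- It lies below the typed configuration. -/
theorem xBad_le : xBad ≤ zF F13 (fun _ => false) := by
  rw [Pi.le_def]; decide

/-- It is badly crossed. -/
theorem xBad_bad : RootBridge.BadlyCrossedConf ends13 0 1 2 3 4 xBad := by
  refine ⟨⟨?_, ?_, ?_⟩, ?_, ?_⟩ <;> decide +kernel

/-- The instance is not mild. -/
theorem notMild13 : ¬ RootBridge.MildInst ends13 0 1 2 3 4 F13 (fun _ => false) := fun h =>
  h.not_bad xBad xBad_le xBad_bad

/-- The configuration `o–u, u–a₁`: `o` reaches `a₁` without `a₃`. -/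
def xO : Config (Fin 13) := fun e => decide (e = 0 ∨ e = 2)

/-- It lies below the typed configuration. -/
theorem xO_le : xO ≤ zF F13 (fun _ => false) := by
  rw [Pi.le_def]; decide

/-- `o` is not behind `a₃`. -/
theorem notOBehind13 : ¬ RootBridge.OBehindA3 ends13 0 1 2 3 F13 (fun _ => false) := fun h =>
  absurd ((h.behind xO xO_le).1 (by decide +kernel)) (by decide +kernel)

/-! ## The assembly -/

/-- **The domain of record is not empty**: p3 g6's 13-edge instance satisfies the twelve
conditions of `ResidualCoreNHatCTBRASUDO7`. -/
theorem instance13_mem : ResidualCoreNHatCTBRASUDO7 ends13 0 1 2 3 4 F13 :=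
  ⟨(ResidualCoreNHatCTBRASUDO_iff ends13 0 1 2 3 4 F13).2
    ⟨core13, noHats13, noRootCut13, noTwoTerminal13, noRootBundle13, noCutRoots13, noCutRootsA3_13,
      noOneStar13, notMild13, by decide, notOBehind13⟩, by decide⟩

/-- The same instance, in the flat vocabulary: the twelve hypotheses of `FlatDomain7_all` are
satisfiable, so the sentence of record is not vacuous. -/
theorem instance13_flat :
    ResidualCore ends13 0 1 2 3 4 F13 ∧ ¬ Hats ends13 0 1 2 3 4 F13 ∧
    ¬ HasRootCut ends13 0 1 2 3 4 F13 ∧ ¬ HasTwoTerminalPart ends13 0 1 2 3 4 F13 ∧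
    ¬ HasRootBundle ends13 0 1 2 3 4 F13 ∧ ¬ RootBridge.HasCutRoots ends13 0 1 2 3 4 F13 ∧
    ¬ RootBridge.HasCutRootsA3 ends13 0 1 2 3 4 F13 ∧ ¬ OneStar ends13 0 1 2 3 4 F13 ∧
    ¬ RootBridge.MildInst ends13 0 1 2 3 4 F13 (fun _ => false) ∧ (0 : Fin 9) ≠ 4 ∧
    ¬ RootBridge.OBehindA3 ends13 0 1 2 3 F13 (fun _ => false) ∧ 7 ≤ F13.card :=
  ⟨core13, noHats13, noRootCut13, noTwoTerminal13, noRootBundle13, noCutRoots13, noCutRootsA3_13,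
    noOneStar13, notMild13, by decide, notOBehind13, by decide⟩

end NonVacuity

end TypedRed

end CovForm

end Summit.Ventures.PercRepro2
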